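import Literature.NumberTheory.Transcendental.KZCalculus
import Mathlib.MeasureTheory.Constructions.Pi
import Mathlib.Analysis.SpecialFunctions.Integrals.Basic

/-!
# `StokesGeneration` (stmt-3586), line `fibrewise_stokes`, rung stub R1 — value of a simple-real-pole representation

The registered stub `stub_rungValue` of the line `Cruxes/StokesGeneration/Lines/fibrewise_stokes.lean`
(Baker sector of the residual S2, rung R1): if `t` is an integral representation on the closed unit
cube of `ℝ¹ = (Fin 1 → ℝ)` whose integrand agrees on the cube with `z ↦ Σᵢ cᵢ/(z 0 − aᵢ)`, all poles
`aᵢ` real and outside `[0,1]` (`aᵢ < 0` or `1 < aᵢ`), then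
`t.value = ∫_{[0,1]} Σᵢ cᵢ/(z − aᵢ) dz = Σᵢ cᵢ log(1 − 1/aᵢ)`.
Proof: transport the set integral over the cube of `ℝ¹` to `∫ y in Icc 0 1` along the
volume-preserving `MeasurableEquiv.funUnique (Fin 1) ℝ`, pass to the interval integral, split the
finite sum (each summand is continuous on `[0,1]`), and evaluate
`∫₀¹ (y − a)⁻¹ dy = ∫_{−a}^{1−a} x⁻¹ dx = log((1 − a)/(−a)) = log(1 − a⁻¹)` by Mathlib's `integral_inv`.
[Kontsevich–Zagier 2001, §1.1]
-/

noncomputable section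

set_option linter.dupNamespace false

namespace Summit.KontsevichZagierPeriods.KontsevichZagierPeriods.Cruxes.StokesGeneration.FibrewiseStokes

open MeasureTheory Set
open Literature.NumberTheory.Transcendental
open Literature.NumberTheory.Transcendental.KZ

/-- The closed unit cube of `ℝ¹ = (Fin 1 → ℝ)` is the preimage of `[0,1]` under evaluation at the
unique coordinate (`MeasurableEquiv.funUnique`). [folklore] -/
theorem cubePi_one_eq_preimage_funUnique :
    Set.pi Set.univ (fun _ : Fin 1 => Set.Icc (0:ℝ) 1) =
      (MeasurableEquiv.funUnique (Fin 1) ℝ) ⁻¹' Set.Icc (0:ℝ) 1 := by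
  ext x
  simp only [Set.mem_univ_pi, Fin.forall_fin_one, Set.mem_preimage]
  exact Iff.rfl

/-- **Transport `ℝ¹ → ℝ` on the unit cube**: for any `g : ℝ → ℝ`,
`∫_{[0,1]¹} g (x 0) dx = ∫_{[0,1]} g (y) dy` (the evaluation `MeasurableEquiv.funUnique (Fin 1) ℝ` is
volume preserving, `MeasureTheory.volume_preserving_funUnique`). [folklore] -/
theorem setIntegral_cubePi_one_eq (g : ℝ → ℝ) :
    ∫ x in Set.pi Set.univ (fun _ : Fin 1 => Set.Icc (0:ℝ) 1), g (x 0) =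
      ∫ y in Set.Icc (0:ℝ) 1, g y := by
  rw [cubePi_one_eq_preimage_funUnique]
  exact (volume_preserving_funUnique (Fin 1) ℝ).setIntegral_preimage_emb
    (MeasurableEquiv.measurableEmbedding _) g (Set.Icc (0:ℝ) 1)

/-- A simple real pole outside `[0,1]` gives an integrand continuous on `[0,1]`:
`y ↦ c/(y − a)` is interval integrable on `0..1` when `a < 0` or `1 < a`. [folklore] -/
theorem intervalIntegrable_const_div_sub_pole (c : ℝ) {a : ℝ} (ha : a < 0 ∨ 1 < a) :
    IntervalIntegrable (fun y : ℝ => c / (y - a)) volume 0 1 := by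
  refine (continuousOn_const.div ((continuous_sub_right a).continuousOn) ?_).intervalIntegrable
  intro y hy
  rw [Set.uIcc_of_le zero_le_one, Set.mem_Icc] at hy
  rw [sub_ne_zero]
  rcases ha with h | h
  · exact (h.trans_le hy.1).ne'
  · exact (hy.2.trans_lt h).ne

/-- **The elementary logarithmic integral**: for a real pole `a ∉ [0,1]` (`a < 0` or `1 < a`),
`∫₀¹ c/(y − a) dy = c · log(1 − a⁻¹)` (substitute `x = y − a` and use `∫ x⁻¹ = log`, Mathlib's
`integral_inv`; `(1 − a)/(−a) = 1 − a⁻¹`). [folklore] -/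
theorem intervalIntegral_const_div_sub_pole (c : ℝ) {a : ℝ} (ha : a < 0 ∨ 1 < a) :
    ∫ y in (0:ℝ)..1, c / (y - a) = c * Real.log (1 - a⁻¹) := by
  have ha0 : a ≠ 0 := by
    rcases ha with h | h
    · exact h.ne
    · exact (one_pos.trans h).ne'
  have h0 : (0:ℝ) ∉ Set.uIcc (0 - a) (1 - a) := by
    intro h
    rw [Set.uIcc_of_le (by linarith), Set.mem_Icc] at h
    obtain ⟨h1, h2⟩ := h
    rcases ha with h' | h' <;> linarith
  have heq : (fun y : ℝ => c / (y - a)) = fun y => c * (y - a)⁻¹ := by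
    funext y
    rw [div_eq_mul_inv]
  rw [heq, intervalIntegral.integral_const_mul, intervalIntegral.integral_comp_sub_right (fun x : ℝ => x⁻¹) a,
    integral_inv h0]
  congr 1
  rw [show (1 - a) / (0 - a) = 1 - a⁻¹ by field_simp; ring]

/-- STUB R1 (rung, Baker sector) **value of a simple-real-pole representation**: if `t : IntegralRep 1`
has domain the closed unit cube of `ℝ¹` and integrand agreeing there with `z ↦ Σᵢ cᵢ/(z 0 − aᵢ)`,
all `aᵢ ∉ [0,1]` (`aᵢ < 0` or `1 < aᵢ`), then `t.value = Σᵢ cᵢ log(1 − 1/aᵢ)`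
(transport `ℝ¹ → ℝ`, `∫ (z − a)⁻¹ = log`). [cite: KontsevichZagier2001, §1.1] -/
theorem stub_rungValue :
    ∀ (s : ℕ) (a c : Fin s → ℝ), (∀ i, a i < 0 ∨ 1 < a i) → ∀ (t : IntegralRep 1),
      t.domain = Set.pi Set.univ (fun _ : Fin 1 => Set.Icc (0:ℝ) 1) →
      (∀ z ∈ Set.pi Set.univ (fun _ : Fin 1 => Set.Icc (0:ℝ) 1), t.integrand z = ∑ i, c i / (z 0 - a i)) →
      t.value = ∑ i, c i * Real.log (1 - (a i)⁻¹) := by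
  intro s a c ha t ht hti
  have hmeas : MeasurableSet (Set.pi Set.univ (fun _ : Fin 1 => Set.Icc (0:ℝ) 1)) :=
    MeasurableSet.univ_pi fun _ => measurableSet_Icc
  rw [IntegralRep.value, ht, setIntegral_congr_fun hmeas hti,
    setIntegral_cubePi_one_eq (fun y => ∑ i, c i / (y - a i)), integral_Icc_eq_integral_Ioc,
    ← intervalIntegral.integral_of_le zero_le_one,
    intervalIntegral.integral_finsetSum (s := Finset.univ)
      (fun i _ => intervalIntegrable_const_div_sub_pole (c i) (ha i))]
  exact Finset.sum_congr rfl fun i _ => intervalIntegral_const_div_sub_pole (c i) (ha i)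

end Summit.KontsevichZagierPeriods.KontsevichZagierPeriods.Cruxes.StokesGeneration.FibrewiseStokes

end
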